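import Summits.ResolutionOfSingularities.ResolutionOfSingularities.Theorems.WeightedInvariantLocalWeightedDropWildPurePowerFlagKangarooTransport
import Summits.ResolutionOfSingularities.ResolutionOfSingularities.Theorems.WeightedInvariantLocalWeightedDropWildPurePowerFlagDropZeroMore
import Summits.ResolutionOfSingularities.ResolutionOfSingularities.Theorems.WeightedInvariantLocalWeightedDropWildPurePowerFlagDropSplit

/-!
# `WeightedInvariant.LocalWeightedDrop`, line `hasse-ridge-face-selection`, piece S3πM: [HP24, Prop. 4] CASE (iv) on the
# game-side flag invariant (series), for the translated successor (`t ≠ 0`, kangaroo configuration) and the axis successor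

Crux item stmt-ResolutionOfSingularities-8899 `LocalWeightedDrop` (route `ResolutionOfSingularities/WeightedInvariant`), serving the
door `WeightedConstruction` stmt-ResolutionOfSingularities-0571.  [OURS · L1 W4.3, chain w43, stub worker 2 (gen 3); game-side
counterpart of the atlas-model theorems `invCaseTangent_step_lt_invCaseTangent_shearFlag` / `…_lt_invCaseN0_shearFlag`
(`Literature/…/PointBlowupFlagKangarooCase`, p506677) of the same seat.  Not a statement of any manuscript.  Printed source:
H. Hauser, S. Perlega, *Resolving surface singularities in positive characteristic*, Publ. RIMS **60** (2024), Prop. 4 p. 793 and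
its proof, case (iv), pp. 795–797.]

With the transport of `…FlagKangarooTransport` (`exists_dt_stepT`, `exists_mul_ordH_add_le_of_stepZero`, `dFlag_swap_lt`):

* `exists_gt_of_isTangent_swap_stepT` — **CASE (iv), `t ≠ 0`, `E = V(xy)`**: the child flag `V(x′ + g(y′))`, `ord g ≥ 2`, has
  `(d_𝓖, n, 0) < (d_t, 1, 0)`, the triple of the parent flag `y − t·x`;
  `exists_gt_of_swap_zero_stepT` — the child flag `V(x′)` itself: `(d′_res, 0, s) < (d_t, 1, 0)`;
  `exists_gt_of_isFlagTriple_stepT` — with `exists_gt_of_isN0_stepT` (case (ii), `…FlagStepT`): EVERY flag triple of the cleaned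
  translated successor is dominated; **`dropKangarooStatement_holds : DropKangarooStatement p e k`** — res-L1-w43-stub-1's second
  typed hypothesis of `dropStatement_of_split` (`…FlagDropSplit`, p509218), DISCHARGED.
* `exists_gt_of_isTangent_swap_stepZero` — **CASE (iv), `t = 0`**, tangency `≥ 2`: `(d_𝓖, n, 0) < (d_res, 0, s_{V(y)})`, the
  residual order of the PARENT being positive because the child is not terminal (`d′_res ≤ d_res`, res-D-pv-058's
  `dRes_stepZero_le`); **`dropZero_piece_iv`** — VERBATIM the hypothesis `hiv` of stub-1's `dropZeroStatement_of_pieces`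
  (`…FlagDropZeroAssembly`, p510442) (the tangency-1 child at `t = 0` is stub-1's `InvN1`).

Status note (res-L1-w43-plan-1 RULING gen 9 #3 (R2), 2026-08-27): S3πM is closed by name through `PureDescent` (p510457); these
files complete the independent HP24-Prop-4 proof on series as banked helpers.
-/

set_option linter.dupNamespace false -- mandated namespace of this single-conjunct summit

namespace Summit.ResolutionOfSingularities.ResolutionOfSingularities.Theorems

open Literature.AlgebraicGeometry.Resolution
open Literature.AlgebraicGeometry.Resolution.HauserPerlega2024

namespace PurePowerFlag

open MvPowerSeries

variable {k : Type} [Field k]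

/-! ### [HP24, Prop. 4] case (iv) for the translated successor, `t ≠ 0`, `E = V(xy)` -/

/-- **[HP24, Prop. 4] CASE (iv), `t ≠ 0`, BOTH LETTERS EXCEPTIONAL** ("Now consider the case `n_𝓕 = 1`", p. 797): along the
translated successor `x^q·T = B(x, x(t+y))` (`q = pᵉ`, `e ≥ 1`, `B` clean non-zero of order `> q`), every flag `V(x′ + g(y′))` of the
cleaned successor `C` tangent to the new exceptional curve with `ord g ≥ 2` (datum `(true, g)`) has flag triple `(d_𝓖, n_𝓖, 0)`
strictly below the triple `(d_t, 1, 0)` of the parent flag `y − t·x`, provided `C` is not terminal up to a triangular change. -/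
theorem exists_gt_of_isTangent_swap_stepT (p : ℕ) [hp : Fact p.Prime] [CharP k p] {e : ℕ} (he : 1 ≤ e)
    {B T : MvPowerSeries (Fin 2) k} (hB0 : B ≠ 0) (hBclean : cleanSeries (p ^ e) B = B)
    (hq : ((p ^ e : ℕ) : ℕ∞) < B.order) {t : k} (ht : t ≠ 0)
    (hT : (X 0 : MvPowerSeries (Fin 2) k) ^ (p ^ e) * T = subst (PlaneGerm.dirChart t) B) {E : Finset (Fin 2)}
    (h0E : (0 : Fin 2) ∈ E) (h1E : (1 : Fin 2) ∈ E) (hnt : ¬ TermSub (p ^ e) (cleanSeries (p ^ e) T))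
    (g : PowerSeries k) (hTan : IsTangent (orientE true (succE t E)) g) :
    ∃ v : Triple, IsFlagTriple (p ^ e) B E v ∧
      flagTriple (p ^ e) (orient true (cleanSeries (p ^ e) T)) (orientE true (succE t E)) g < v := by
  classical
  set q := p ^ e with hqdef
  set C := cleanSeries q T with hCdef
  set hpar : PowerSeries k := PowerSeries.C t * PowerSeries.X with hpar_def
  set B₀ := expansion q B hpar with hB₀
  have hE' : succE t E = {0} := by unfold succE; rw [if_neg (fun h => ht h.1)]
  have hpar0 : PowerSeries.constantCoeff hpar = 0 := by
    rw [hpar_def, map_mul, PowerSeries.constantCoeff_X, mul_zero]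
  have hparTan : IsTangent E hpar := isTangent_C_mul_X h0E h1E ht
  refine ⟨flagTriple q B E hpar, ⟨false, hpar, hpar0, Or.inr hparTan, by rw [orient_false, orientE_false]⟩, ?_⟩
  rw [hE', orientE_true, swapE_singleton_zero] at hTan
  rw [hE', orient_true, orientE_true, swapE_singleton_zero, flagTriple_of_not_isN0 q (swap C) hTan.not_isN0,
    flagTriple_of_not_isN0 q B hparTan.not_isN0, tangency_C_mul_X ht]
  obtain ⟨-, hg0, hg2⟩ := hTan
  have hg2' : (2 : ℕ∞) ≤ g.order := by
    rcases hg2 with h | h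
    · exact h
    · exact absurd (Finset.mem_singleton.mp h) (by decide)
  obtain ⟨hordg, hn2⟩ := tangency_spec_of_two_le hg0 hg2'
  set n := tangency g with hndef
  -- the step relation for `(B₀, C)` and `C ≠ 0`
  have hstep : (X 0 : MvPowerSeries (Fin 2) k) ^ q * C = subst (PlaneGerm.dirChart (0 : k)) B₀ :=
    X_pow_mul_clean_eq_stepZero_expansion q t hT
  have hB₀ne : B₀ ≠ 0 := expansion_ne_zero p e hB0 hBclean hpar hpar0
  have hC0 : C ≠ 0 := ne_zero_stepZero q hB₀ne hstep
  have hCclean : cleanSeries q C = C := cleanSeries_cleanSeries q T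
  -- `d_t = d₀ 1 ≥ 1`
  obtain ⟨d₀, hd₀, hd₀deg, hdFlag, hpos, -⟩ := exists_dt_stepT q hq hT hC0 hnt
  -- `n · ord H ≤ d₀ 1`
  obtain ⟨dhi, -, hle⟩ := exists_mul_ordH_add_le_of_stepZero q (n := n) (by omega) hC0 hstep
  have hB := hle d₀ hd₀ hd₀deg
  have hlt : dFlag q (swap C) g n < d₀ 1 :=
    dFlag_swap_lt p he hC0 hCclean hordg hn2 hpos (le_trans (Nat.le_add_right _ _) hB)
  rw [hdFlag]
  exact Prod.Lex.toLex_lt_toLex.mpr (Or.inl hlt)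

/-- **The child flag `V(x′)` itself** (datum `(true, 0)`, an `n = 0` flag of the swap with the new exceptional letter): its triple
`(dRes (swap C) {1}, 0, s) = (d′_res, 0, s)` lies strictly below `(d_t, 1, 0)`, by Figure 1 (`d′_res ≤ d_t`). [HP24 Prop. 4 (ii) p. 795] -/
theorem exists_gt_of_swap_zero_stepT (p : ℕ) [hp : Fact p.Prime] [CharP k p] (e : ℕ)
    {B T : MvPowerSeries (Fin 2) k} (hB0 : B ≠ 0) (hBclean : cleanSeries (p ^ e) B = B)
    (hq : ((p ^ e : ℕ) : ℕ∞) < B.order) {t : k} (ht : t ≠ 0)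
    (hT : (X 0 : MvPowerSeries (Fin 2) k) ^ (p ^ e) * T = subst (PlaneGerm.dirChart t) B) {E : Finset (Fin 2)}
    (h0E : (0 : Fin 2) ∈ E) (h1E : (1 : Fin 2) ∈ E) (hnt : ¬ TermSub (p ^ e) (cleanSeries (p ^ e) T))
    (g : PowerSeries k) (hN0 : IsN0 (orientE true (succE t E)) g) :
    ∃ v : Triple, IsFlagTriple (p ^ e) B E v ∧
      flagTriple (p ^ e) (orient true (cleanSeries (p ^ e) T)) (orientE true (succE t E)) g < v := by
  classical
  set q := p ^ e with hqdef
  set C := cleanSeries q T with hCdef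
  set hpar : PowerSeries k := PowerSeries.C t * PowerSeries.X with hpar_def
  set B₀ := expansion q B hpar with hB₀
  have hE' : succE t E = {0} := by unfold succE; rw [if_neg (fun h => ht h.1)]
  have hpar0 : PowerSeries.constantCoeff hpar = 0 := by
    rw [hpar_def, map_mul, PowerSeries.constantCoeff_X, mul_zero]
  have hparTan : IsTangent E hpar := isTangent_C_mul_X h0E h1E ht
  refine ⟨flagTriple q B E hpar, ⟨false, hpar, hpar0, Or.inr hparTan, by rw [orient_false, orientE_false]⟩, ?_⟩
  rw [flagTriple_of_isN0 q _ hN0, flagTriple_of_not_isN0 q B hparTan.not_isN0, tangency_C_mul_X ht, hE', orient_true,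
    orientE_true, dRes_swap]
  have hstep : (X 0 : MvPowerSeries (Fin 2) k) ^ q * C = subst (PlaneGerm.dirChart (0 : k)) B₀ :=
    X_pow_mul_clean_eq_stepZero_expansion q t hT
  have hB₀ne : B₀ ≠ 0 := expansion_ne_zero p e hB0 hBclean hpar hpar0
  have hC0 : C ≠ 0 := ne_zero_stepZero q hB₀ne hstep
  obtain ⟨d₀, -, -, hdFlag, -, hres⟩ := exists_dt_stepT q hq hT hC0 hnt
  rw [hdFlag, Prod.Lex.toLex_lt_toLex]
  rcases hres.lt_or_eq with hlt | heq
  · exact Or.inl hlt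
  · exact Or.inr ⟨heq, Prod.Lex.toLex_lt_toLex.mpr (Or.inl zero_lt_one)⟩

/-- **[HP24, Prop. 4] for the translated successor with both letters exceptional** (cases (ii) and (iv), `t ≠ 0`, `E_a = V(xy)`):
EVERY admissible flag triple of the cleaned successor `(C, succE t E)` is strictly dominated by an admissible flag triple of the parent
`(B, E)` — the clause set of res-L1-w43-stub-1's `DropKangarooStatement`. [HP24 Prop. 4 p. 793; proof pp. 795–797] -/
theorem exists_gt_of_isFlagTriple_stepT (p : ℕ) [hp : Fact p.Prime] [CharP k p] {e : ℕ} (he : 1 ≤ e)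
    {B T : MvPowerSeries (Fin 2) k} (hB0 : B ≠ 0) (hBclean : cleanSeries (p ^ e) B = B)
    (hq : ((p ^ e : ℕ) : ℕ∞) < B.order) {t : k} (ht : t ≠ 0)
    (hT : (X 0 : MvPowerSeries (Fin 2) k) ^ (p ^ e) * T = subst (PlaneGerm.dirChart t) B) {E : Finset (Fin 2)}
    (h0E : (0 : Fin 2) ∈ E) (h1E : (1 : Fin 2) ∈ E) (hnt : ¬ TermSub (p ^ e) (cleanSeries (p ^ e) T))
    (w : Triple) (hw : IsFlagTriple (p ^ e) (cleanSeries (p ^ e) T) (succE t E) w) :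
    ∃ v : Triple, IsFlagTriple (p ^ e) B E v ∧ w < v := by
  obtain ⟨o, g, hg0, hcase, rfl⟩ := hw
  cases o with
  | false =>
    simp only [orient_false, orientE_false] at hcase ⊢
    rcases hcase with hN0 | hTan
    · exact exists_gt_of_isN0_stepT (p ^ e) hq ht hT h0E h1E hnt g hN0
    · -- no tangent flag of the first orientation: `y′` is not exceptional
      exfalso
      have hE' : succE t E = {0} := by unfold succE; rw [if_neg (fun h => ht h.1)]
      rw [hE'] at hTan
      exact absurd (Finset.mem_singleton.mp hTan.1) (by decide)
  | true =>
    rcases hcase with hN0 | hTan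
    · exact exists_gt_of_swap_zero_stepT p e hB0 hBclean hq ht hT h0E h1E hnt g hN0
    · exact exists_gt_of_isTangent_swap_stepT p he hB0 hBclean hq ht hT h0E h1E hnt g hTan

/-- **`DropKangarooStatement p e k` HOLDS** (res-L1-w43-stub-1's `…FlagDropSplit`; for `e = 0` the cleaning hypothesis forces
`B = 0`). [HP24 Prop. 4 p. 793, cases (ii)/(iv) with `t ≠ 0`, `E_a = V(xy)`] -/
theorem dropKangarooStatement_holds (p : ℕ) [hp : Fact p.Prime] [CharP k p] (e : ℕ) : DropKangarooStatement p e k := by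
  intro B E t T hBclean hB0 hq _ ht h0E h1E hT _ hnt w hw
  rcases Nat.eq_zero_or_pos e with rfl | he
  · exfalso
    rw [pow_zero, cleanSeries_one] at hBclean
    exact hB0 hBclean.symm
  · exact exists_gt_of_isFlagTriple_stepT p he hB0 hBclean hq ht hT h0E h1E hnt w hw

/-! ### [HP24, Prop. 4] case (iv) for the axis successor, `t = 0`, tangency `≥ 2` -/

/-- **[HP24, Prop. 4] CASE (iv), `t = 0`** ("Let us first assume that `n_𝓕 = 0`", p. 795): along the axis successor
`x^q·T = B(x, xy)` (`q = pᵉ`, `e ≥ 1`, `B` clean non-zero of order `> q`), every flag `V(x′ + g(y′))` of the successor with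
tangency `≥ 2` (datum `(true, g)`, read on the swap) has flag triple `(d_𝓖, n_𝓖, 0)` strictly below the triple `(d_res, 0, s)` of the
parent flag `V(y)` (datum `f = 0`), provided the successor is not terminal up to a triangular change (which makes
`d_res ≥ d′_res ≥ 1`): `d_𝓖 ≤ ord H + ε`, `n·ord H ≤ j − ord_y B ≤ ord B − ord_x B − ord_y B ≤ d_res`, `kangaroo_arith`. -/
theorem exists_gt_of_isTangent_swap_stepZero (p : ℕ) [hp : Fact p.Prime] [CharP k p] {e : ℕ} (he : 1 ≤ e)
    {B T : MvPowerSeries (Fin 2) k} (hB0 : B ≠ 0) (hBclean : cleanSeries (p ^ e) B = B)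
    (hq : ((p ^ e : ℕ) : ℕ∞) < B.order)
    (hT : (X 0 : MvPowerSeries (Fin 2) k) ^ (p ^ e) * T = subst (PlaneGerm.dirChart (0 : k)) B) (E : Finset (Fin 2))
    (hnt : ¬ TermSub (p ^ e) T) (g : PowerSeries k) (hTan : IsTangent (swapE (succE (0 : k) E)) g)
    (hn2 : 2 ≤ tangency g) :
    ∃ f : PowerSeries k, PowerSeries.constantCoeff f = 0 ∧ (IsN0 E f ∨ IsTangent E f) ∧
      flagTriple (p ^ e) (swap T) (swapE (succE (0 : k) E)) g < flagTriple (p ^ e) B E f := by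
  classical
  set q := p ^ e with hqdef
  set E' := succE (0 : k) E with hE'def
  have hCT : cleanSeries q T = T := cleanSeries_of_stepZero q hBclean hT
  refine ⟨0, map_zero _, Or.inl (Or.inr rfl), ?_⟩
  rw [flagTriple_of_not_isN0 q (swap T) hTan.not_isN0, flagTriple_of_isN0 q B (Or.inr rfl : IsN0 E (0 : PowerSeries k))]
  -- `ord g = n ≥ 2`
  have hfin : g.order ≠ ⊤ := by
    intro htop
    have : tangency g = 0 := by unfold tangency; rw [htop, ENat.toNat_top]
    omega
  have hordg : g.order = ((tangency g : ℕ) : ℕ∞) := by unfold tangency; exact (ENat.coe_toNat hfin).symm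
  set n := tangency g with hndef
  have hT0 : T ≠ 0 := ne_zero_stepZero q hB0 hT
  -- the boundary of the successor
  have h0E' : (0 : Fin 2) ∈ E' := by
    rw [hE'def]; unfold succE
    split_ifs
    · exact Finset.mem_insert_self _ _
    · exact Finset.mem_singleton_self _
  have h1E' : (1 : Fin 2) ∈ E' ↔ (1 : Fin 2) ∈ E := by
    rw [hE'def]; unfold succE
    split_ifs with h
    · exact ⟨fun _ => h.2, fun _ => Finset.mem_insert_of_mem (Finset.mem_singleton_self _)⟩
    · refine ⟨fun h1 => absurd (Finset.mem_singleton.mp h1) (by decide), fun h1 => absurd ⟨rfl, h1⟩ h⟩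
  -- `1 ≤ d′_res ≤ d_res`
  have hdres1 : 1 ≤ dRes B E := by
    have hle : dRes T E' ≤ dRes B E := dRes_stepZero_le q hB0 hq.le hT h0E' h1E'
    rcases Nat.eq_zero_or_pos (dRes T E') with h0 | hpos
    · exact absurd (termSub_of_dRes_eq_zero E' hT0 hCT h0) hnt
    · omega
  -- `n · ord H ≤ d_res`
  obtain ⟨dhi, hdhi, hle⟩ := exists_mul_ordH_add_le_of_stepZero q (n := n) (by omega) hT0 hT
  obtain ⟨d₁, hd₁, hd₁deg⟩ := exists_coeff_ne_zero_degree_eq_order hB0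
  have hB := hle d₁ hd₁ hd₁deg
  have hsplit := order_toNat_eq_excExp_add_dRes hB0 E
  have hex0 : excExp B E 0 ≤ d₁ 0 := excExp_le_of_coeff_ne_zero B E hd₁ 0
  have hex1 : excExp B E 1 ≤ dhi 1 := excExp_le_of_coeff_ne_zero B E hdhi 1
  have hlt : dFlag q (swap T) g n < dRes B E :=
    dFlag_swap_lt p he hT0 hCT hordg hn2 hdres1 (by omega)
  exact Prod.Lex.toLex_lt_toLex.mpr (Or.inl hlt)

/-- **The hypothesis `hiv` of res-L1-w43-stub-1's `dropZeroStatement_of_pieces`** (`…FlagDropZeroAssembly`, p510442), VERBATIM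
(for `e = 0` the cleaning hypothesis forces `B = 0`). [HP24 Prop. 4 p. 793, case (iv) with `t = 0`] -/
theorem dropZero_piece_iv (p : ℕ) [hp : Fact p.Prime] [CharP k p] (e : ℕ) :
    ∀ (B : MvPowerSeries (Fin 2) k) (E : Finset (Fin 2)) (T : MvPowerSeries (Fin 2) k),
      cleanSeries (p ^ e) B = B → B ≠ 0 → ((p ^ e : ℕ) : ℕ∞) < B.order →
      X 0 ^ (p ^ e) * T = subst (PlaneGerm.dirChart (0 : k)) B →
      ((p ^ e : ℕ) : ℕ∞) < T.order → ¬ TermSub (p ^ e) T →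
      ∀ g : PowerSeries k, PowerSeries.constantCoeff g = 0 → IsTangent (swapE (succE (0 : k) E)) g → 2 ≤ tangency g →
        ∃ f : PowerSeries k, PowerSeries.constantCoeff f = 0 ∧ (IsN0 E f ∨ IsTangent E f) ∧
          flagTriple (p ^ e) (swap T) (swapE (succE (0 : k) E)) g < flagTriple (p ^ e) B E f := by
  intro B E T hBclean hB0 hq hT _ hnt g _ hTan hn2
  rcases Nat.eq_zero_or_pos e with rfl | he
  · exfalso
    rw [pow_zero, cleanSeries_one] at hBclean
    exact hB0 hBclean.symm
  · exact exists_gt_of_isTangent_swap_stepZero p he hB0 hBclean hq hT E hnt g hTan hn2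

end PurePowerFlag

end Summit.ResolutionOfSingularities.ResolutionOfSingularities.Theorems
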